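/-
HONEST FRAMING: certified error envelopes and provably optimal rounding/accumulation schemes for
low-precision formats under stated cost models; every table by two implementations; no hardware
or vendor claims.
-/
import Summits.Ventures.CertifiedArithmetic.LowPrec.OptDemotionRoutingCfgShift

/-!
# The demotion law (Theorem T8), part 11-2: the node rule at an ARBITRARY top exponent, and the rows (M), (MC), gap convexity in `insert`-form

Part 11 (the whole top-level e-side of opt's split at `ρ = u`, EVERY popcount, every `q`;
HOME E-SIDE-TOPLEVEL.md, PART11-DESIGN.md) works with UN-NORMALISED integer configurations: a set
`S` of exponents in `[1-q, -2]` and the four configurations `{-1} ∪ S`, `{0} ∪ S`, `{-q} ∪ S`,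
`{e-q} ∪ S` of the rows `E(S)` / `Φ(S; e)` (parts 11-4, 11-5).  This file supplies the tools in that
language:
* `injected_le_treeBR_node_top`, `treeBR_node_le_top` — part 10k-0's node rule (`split_le_injected`,
  `injected_le_treeBR_node`, `treeBR_node_le_of_injected`) for a configuration `{e₀} ∪ T`,
  `T ⊆ [e₀+1-q, e₀-1]`, with an arbitrary top exponent `e₀` (by homogeneity, part 8j): the value at
  a node is `2^e₀ +` the best injected option `BR_X({e₀} ∪ P) + BR_Y({e₀-q} ∪ (T ∖ P))`, `P ⊆ T`;
* `two_treeBR_insert_le` — (MC) (part 8h) in the direction of a lowest isolated bit `i`: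
  `2 BR({i} ∪ C) ≤ BR({i+1} ∪ C) + BR(C)`;
* `treeBR_gc_insert` — gap convexity (part 10d, opt R28) at the three positions
  `e-q < -1-q < -q` below `C`, scaled: `(2 - 2·2^e) BR({-1-q} ∪ C) ≤ BR({e-q} ∪ C) + (1 - 2·2^e) BR({-q} ∪ C)`;
* `treeBR_le_of_subset_of_bounds` — (M) for sub-configurations inside a window of `q` places;
* `treeBR_node_comm`, small shift identities.
-/

namespace Summit.Ventures.CertifiedArithmetic.LowPrec.Opt

open Literature.ComputerArithmetic.JeannerodRump2018
open Literature.ComputerArithmetic.JeannerodRump2018.SumTree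

section CfgTop

variable {q : ℕ}

/-! ## Small tools -/

/-- The routing value does not see the order of the two children. -/
theorem treeBR_node_comm (A B : SumTree) (S : Finset ℤ) :
    treeBR q (.node B A) S = treeBR q (.node A B) S := by
  unfold treeBR; exact treeBRw_node_comm q _ B A S

/-- Shifting up by `k` and down by `k` is the identity on configurations. -/
theorem image_add_image_neg (S : Finset ℤ) (k : ℤ) :
    (S.image fun e => e + k).image (fun e => e + -k) = S := by
  rw [Finset.image_image]
  have : ((fun e : ℤ => e + -k) ∘ fun e => e + k) = id := by funext e; simp
  rw [this, Finset.image_id]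

/-- Shifting down by `k` and up by `k` is the identity on configurations. -/
theorem image_neg_image_add (S : Finset ℤ) (k : ℤ) :
    (S.image fun e => e + -k).image (fun e => e + k) = S := by
  rw [Finset.image_image]
  have : ((fun e : ℤ => e + k) ∘ fun e => e + -k) = id := by funext e; simp
  rw [this, Finset.image_id]

/-- (M) for a sub-configuration of a configuration inside a window of `q` binary places. -/
theorem treeBR_le_of_subset_of_bounds (hq : 1 ≤ q) (t : SumTree) {B C : Finset ℤ} (hBC : B ⊆ C)
    {lo : ℤ} (hC : ∀ c ∈ C, lo ≤ c ∧ c ≤ lo + ((q : ℤ) - 1)) : treeBR q t B ≤ treeBR q t C :=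
  treeBR_le_of_subset hq t hBC (routable_of_bounds hC le_rfl)

/-- A shifted pair: `BR{a + k, b + k} = 2^k BR{a, b}`. -/
theorem treeBR_pair_shift' (t : SumTree) (a b k : ℤ) :
    treeBR q t {a + k, b + k} = (2 : ℚ) ^ k * treeBR q t {a, b} := by
  have := treeBR_image_add (q := q) t ({a, b} : Finset ℤ) k
  rw [image_pair_add] at this
  exact this

/-- A shifted triple: `BR{a + k, b + k, c + k} = 2^k BR{a, b, c}`. -/
theorem treeBR_triple_shift' (t : SumTree) (a b c k : ℤ) :
    treeBR q t {a + k, b + k, c + k} = (2 : ℚ) ^ k * treeBR q t {a, b, c} := by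
  have := treeBR_image_add (q := q) t ({a, b, c} : Finset ℤ) k
  rw [Finset.image_insert, image_pair_add] at this
  exact this

/-! ## The node rule at an arbitrary top exponent -/

/-- **THE NODE RULE, LOWER HALF, ANY TOP**: for `T ⊆ [e₀+1-q, e₀-1]` and `P ⊆ T`, the injected option
`({e₀} ∪ P | {e₀-q} ∪ (T ∖ P))` is realised: `2^e₀ + BR_A({e₀} ∪ P) + BR_B({e₀-q} ∪ (T ∖ P)) ≤ BR_{A·B}({e₀} ∪ T)`. -/
theorem injected_le_treeBR_node_top (hq : 1 ≤ q) (A B : SumTree) {e₀ : ℤ} {T : Finset ℤ}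
    (hT : ∀ t ∈ T, e₀ + 1 - (q : ℤ) ≤ t ∧ t + 1 ≤ e₀) {P : Finset ℤ} (hP : P ⊆ T) :
    (2 : ℚ) ^ e₀ + (treeBR q A (insert e₀ P) + treeBR q B (insert (e₀ - q) (T \ P))) ≤
      treeBR q (.node A B) (insert e₀ T) := by
  classical
  set f : ℤ → ℤ := fun e => e + -e₀ with hf
  have hinj : Function.Injective f := add_injective (k := -e₀)
  have hT' : ∀ t ∈ T.image f, 1 - (q : ℤ) ≤ t ∧ t ≤ -1 := by
    intro t ht
    obtain ⟨s, hs, rfl⟩ := Finset.mem_image.1 ht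
    have := hT s hs; simp only [hf]; omega
  have hP' : P.image f ⊆ T.image f := Finset.image_subset_image hP
  have h := injected_le_treeBR_node (q := q) hq A B hT' hP'
  have e1 : insert 0 (P.image f) = (insert e₀ P).image f := by
    rw [Finset.image_insert]; simp [hf]
  have e2 : insert (-(q : ℤ)) (T.image f \ P.image f) = (insert (e₀ - q) (T \ P)).image f := by
    rw [Finset.image_insert, Finset.image_sdiff _ _ hinj]; congr 1; simp only [hf]; ring
  have e3 : insert 0 (T.image f) = (insert e₀ T).image f := by
    rw [Finset.image_insert]; simp [hf]
  rw [e1, e2, e3, treeBR_image_add, treeBR_image_add, treeBR_image_add] at h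
  have hpos : (0 : ℚ) < (2 : ℚ) ^ e₀ := zpow_pos (by norm_num) _
  have h' := mul_le_mul_of_nonneg_left h hpos.le
  have pw : (2 : ℚ) ^ e₀ * (2 : ℚ) ^ (-e₀) = 1 := by
    rw [← zpow_add₀ (by norm_num : (2 : ℚ) ≠ 0)]; simp
  have eL : (2 : ℚ) ^ e₀ * (1 + ((2 : ℚ) ^ (-e₀) * treeBR q A (insert e₀ P) +
      (2 : ℚ) ^ (-e₀) * treeBR q B (insert (e₀ - q) (T \ P)))) =
      (2 : ℚ) ^ e₀ + (treeBR q A (insert e₀ P) + treeBR q B (insert (e₀ - q) (T \ P))) := by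
    have : ∀ X : ℚ, (2 : ℚ) ^ e₀ * ((2 : ℚ) ^ (-e₀) * X) = X := fun X => by rw [← mul_assoc, pw, one_mul]
    rw [mul_add, mul_one, mul_add, this, this]
  have eR : (2 : ℚ) ^ e₀ * ((2 : ℚ) ^ (-e₀) * treeBR q (.node A B) (insert e₀ T)) =
      treeBR q (.node A B) (insert e₀ T) := by rw [← mul_assoc, pw, one_mul]
  rw [eL, eR] at h'
  exact h'

/-- **THE NODE RULE, ANY TOP**: the value of `{e₀} ∪ T` (`T ⊆ [e₀+1-q, e₀-1]`) at a node is `2^e₀ +`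
at most any `R ≥ 0` dominating every injected option `BR_X({e₀} ∪ P) + BR_Y({e₀-q} ∪ (T ∖ P))`,
`P ⊆ T`, in both orientations. -/
theorem treeBR_node_le_top (hq : 1 ≤ q) (A B : SumTree) {e₀ : ℤ} {T : Finset ℤ}
    (hT : ∀ t ∈ T, e₀ + 1 - (q : ℤ) ≤ t ∧ t + 1 ≤ e₀) {R : ℚ} (hR : 0 ≤ R)
    (hall : ∀ P, P ⊆ T →
      treeBR q A (insert e₀ P) + treeBR q B (insert (e₀ - q) (T \ P)) ≤ R ∧
        treeBR q B (insert e₀ P) + treeBR q A (insert (e₀ - q) (T \ P)) ≤ R) :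
    treeBR q (.node A B) (insert e₀ T) ≤ (2 : ℚ) ^ e₀ + R := by
  classical
  set f : ℤ → ℤ := fun e => e + -e₀ with hf
  set g : ℤ → ℤ := fun e => e + e₀ with hg
  have hinj : Function.Injective f := add_injective (k := -e₀)
  have hT' : ∀ t ∈ T.image f, 1 - (q : ℤ) ≤ t ∧ t ≤ -1 := by
    intro t ht
    obtain ⟨s, hs, rfl⟩ := Finset.mem_image.1 ht
    have := hT s hs; simp only [hf]; omega
  have hpos : (0 : ℚ) < (2 : ℚ) ^ e₀ := zpow_pos (by norm_num) _
  have hneg : (0 : ℚ) < (2 : ℚ) ^ (-e₀) := zpow_pos (by norm_num) _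
  have pw : (2 : ℚ) ^ e₀ * (2 : ℚ) ^ (-e₀) = 1 := by
    rw [← zpow_add₀ (by norm_num : (2 : ℚ) ≠ 0)]; simp
  have key : ∀ (X Y : SumTree) (P' : Finset ℤ), P' ⊆ T.image f →
      treeBR q X (insert e₀ (P'.image g)) + treeBR q Y (insert (e₀ - q) (T \ P'.image g)) ≤ R →
      treeBR q X (insert 0 P') + treeBR q Y (insert (-(q : ℤ)) (T.image f \ P')) ≤ (2 : ℚ) ^ (-e₀) * R := by
    intro X Y P' hP' hle
    have e1 : insert 0 P' = (insert e₀ (P'.image g)).image f := by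
      rw [Finset.image_insert, image_add_image_neg]; simp [hf]
    have e2 : insert (-(q : ℤ)) (T.image f \ P') = (insert (e₀ - q) (T \ P'.image g)).image f := by
      rw [Finset.image_insert, Finset.image_sdiff _ _ hinj, image_add_image_neg]; congr 1; simp only [hf]; ring
    rw [e1, e2, treeBR_image_add, treeBR_image_add, ← mul_add]
    exact mul_le_mul_of_nonneg_left hle hneg.le
  have hsub : ∀ P', P' ⊆ T.image f → P'.image g ⊆ T := by
    intro P' hP' z hz
    obtain ⟨y, hy, rfl⟩ := Finset.mem_image.1 hz
    obtain ⟨s, hs, rfl⟩ := Finset.mem_image.1 (hP' hy)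
    simpa [hf, hg] using hs
  have h := treeBR_node_le_of_injected (q := q) hq A B hT' (R := (2 : ℚ) ^ (-e₀) * R)
    (mul_nonneg hneg.le hR) (fun P' hP' =>
      ⟨key A B P' hP' (hall _ (hsub P' hP')).1, key B A P' hP' (hall _ (hsub P' hP')).2⟩)
  have e3 : insert 0 (T.image f) = (insert e₀ T).image f := by
    rw [Finset.image_insert]; simp [hf]
  rw [e3, treeBR_image_add] at h
  have h' := mul_le_mul_of_nonneg_left h hpos.le
  have eL : (2 : ℚ) ^ e₀ * ((2 : ℚ) ^ (-e₀) * treeBR q (.node A B) (insert e₀ T)) =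
      treeBR q (.node A B) (insert e₀ T) := by rw [← mul_assoc, pw, one_mul]
  have eR : (2 : ℚ) ^ e₀ * (1 + (2 : ℚ) ^ (-e₀) * R) = (2 : ℚ) ^ e₀ + R := by
    rw [mul_add, mul_one, ← mul_assoc, pw, one_mul]
  rw [eL, eR] at h'
  exact h'

/-! ## The rows in `insert`-form -/

/-- **(MC) AT A LOWEST ISOLATED BIT** (part 8h `treeBR_midconvex`, run of length one): for a
configuration `C` lying in `[i+2, i+q-1]`, `2 BR({i} ∪ C) ≤ BR({i+1} ∪ C) + BR(C)`. -/
theorem two_treeBR_insert_le (hq : 1 ≤ q) (t : SumTree) {C : Finset ℤ} {i : ℤ}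
    (hC : ∀ c ∈ C, i + 2 ≤ c ∧ c ≤ i + ((q : ℤ) - 1)) :
    2 * treeBR q t (insert i C) ≤ treeBR q t (insert (i + 1) C) + treeBR q t C := by
  classical
  have hiC : i ∉ C := fun h => by have := hC i h; omega
  have hi1C : i + 1 ∉ C := fun h => by have := hC _ h; omega
  have hS : Routable q (insert i C) := by
    refine routable_of_bounds (lo := i) (hi := i + ((q : ℤ) - 1)) (fun s hs => ?_) le_rfl
    rcases Finset.mem_insert.1 hs with rfl | h
    · constructor <;> omega
    · have := hC s h; omega
  have hS' : Routable q (insert (i + 1) C) := by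
    refine routable_of_bounds (lo := i + 1) (hi := i + 1 + ((q : ℤ) - 1)) (fun s hs => ?_) le_rfl
    rcases Finset.mem_insert.1 hs with rfl | h
    · constructor <;> omega
    · have := hC s h; omega
  have hrun : ∀ n : ℕ, n ≤ 0 → i + (n : ℤ) ∈ insert i C := by
    intro n hn
    have : n = 0 := by omega
    subst this; simp
  have hβ' : i + (((0 : ℕ) : ℤ) + 1) ∉ insert i C := by
    simp only [Nat.cast_zero, zero_add, Finset.mem_insert, not_or]
    exact ⟨by omega, hi1C⟩
  have e1 : insert (i + (((0 : ℕ) : ℤ) + 1))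
      (insert i C \ (Finset.range (0 + 1)).image (fun n : ℕ => i + (n : ℤ))) = insert (i + 1) C := by
    simp only [Nat.cast_zero, zero_add, Finset.range_one, Finset.image_singleton, add_zero]
    rw [Finset.insert_sdiff_of_mem _ (Finset.mem_singleton_self i), Finset.sdiff_singleton_eq_erase,
      Finset.erase_eq_of_notMem hiC]
  have e2 : (insert i C).erase i = C := Finset.erase_insert hiC
  have h := treeBR_midconvex (q := q) t hS (β := i) (j := 0) hrun hβ' (by rw [e1]; exact hS')
  rw [e1, e2] at h
  exact h

/-- **GAP CONVEXITY BELOW A CONFIGURATION, SCALED** (part 10d `treeBR_gap_convex` at the positions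
`e-q < -1-q < -q`, all below `C ⊆ [1-q, e-1]`, `e ≤ -2`):
`0 ≤ (-2 + 2·2^e) BR({-1-q} ∪ C) + BR({e-q} ∪ C) + (1 - 2·2^e) BR({-q} ∪ C)`. -/
theorem treeBR_gc_insert (hq : 1 ≤ q) (t : SumTree) {C : Finset ℤ} {e : ℤ} (he : e ≤ -2)
    (hC : ∀ c ∈ C, 1 - (q : ℤ) ≤ c ∧ c + 1 ≤ e) :
    0 ≤ (-2 + 2 * (2 : ℚ) ^ e) * treeBR q t (insert (-1 - (q : ℤ)) C) +
      treeBR q t (insert (e - q) C) + (1 - 2 * (2 : ℚ) ^ e) * treeBR q t (insert (-(q : ℤ)) C) := by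
  classical
  have hR : ∀ m : ℤ, m ≤ -(q : ℤ) → e - q ≤ m → Routable q (insert m C) := by
    intro m hm hm'
    refine routable_of_bounds (lo := m) (hi := m + ((q : ℤ) - 1)) (fun s hs => ?_) le_rfl
    rcases Finset.mem_insert.1 hs with rfl | h
    · constructor <;> omega
    · have := hC s h; omega
  have h := treeBR_gap_convex (q := q) t (S := C) (m₁ := e - q) (m₂ := -1 - q) (m₃ := -(q : ℤ))
    (by omega) (by omega)
    (fun h => by have := hC _ h; omega) (fun h => by have := hC _ h; omega)
    (fun h => by have := hC _ h; omega)
    (fun s hs => Or.inr (by have := hC s hs; omega))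
    (hR _ (by omega) le_rfl) (hR _ (by omega) (by omega)) (hR _ le_rfl (by omega))
  have pw : ∀ a b : ℤ, (2 : ℚ) ^ (a + b) = (2 : ℚ) ^ a * (2 : ℚ) ^ b := fun a b =>
    zpow_add₀ (by norm_num) a b
  set U : ℚ := (2 : ℚ) ^ (-(q : ℤ)) with hU
  have hU0 : 0 < U := zpow_pos (by norm_num) _
  have p1 : (2 : ℚ) ^ (e - q) = (2 : ℚ) ^ e * U := by
    rw [hU, sub_eq_add_neg, pw]
  have p2 : (2 : ℚ) ^ (-1 - (q : ℤ)) = U * (1 / 2) := by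
    rw [hU, show (1 / 2 : ℚ) = (2 : ℚ) ^ (-1 : ℤ) by norm_num, ← pw, show -(q : ℤ) + -1 = -1 - (q : ℤ) by ring]
  rw [p1, p2] at h
  have key : U * ((2 - 2 * (2 : ℚ) ^ e) * treeBR q t (insert (-1 - (q : ℤ)) C)) ≤
      U * (treeBR q t (insert (e - q) C) + (1 - 2 * (2 : ℚ) ^ e) * treeBR q t (insert (-(q : ℤ)) C)) := by
    nlinarith [h, hU0]
  have := le_of_mul_le_mul_left key hU0
  linarith only [this]

/-- The top of `{-q} ∪ S` made explicit: `{-q} ∪ S = {s₁} ∪ ({-q} ∪ (S ∖ s₁))` for `s₁ ∈ S`. -/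
theorem insert_negq_eq (S : Finset ℤ) {s₁ : ℤ} (hs : s₁ ∈ S) (x : ℤ) :
    insert x S = insert s₁ (insert x (S.erase s₁)) := by
  rw [Finset.insert_comm, Finset.insert_erase hs]

/-- The same with two extra bits. -/
theorem insert_insert_eq (S : Finset ℤ) {s₁ : ℤ} (hs : s₁ ∈ S) (x y : ℤ) :
    insert x (insert y S) = insert s₁ (insert x (insert y (S.erase s₁))) := by
  rw [Finset.insert_comm s₁ x, Finset.insert_comm s₁ y, Finset.insert_erase hs]

end CfgTop

end Summit.Ventures.CertifiedArithmetic.LowPrec.Opt
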